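import Literature.NumberTheory.EllipticCurves.ProfiniteGroupDistribution
import HarnessLib

/-!
# Bounded distributions on a group along a subgroup tower: a MULTIPLICATIVE function is tower-continuous as soon as it tends to `1`
# along the levels (de Shalit 1987, I.3.1: characters of `𝒢` factoring through — or continuous along — the tower are integrable)

Topic `NumberTheory/EllipticCurves`; namespace `Literature.NumberTheory.EllipticCurves.SubgroupTower`.

De Shalit, *Iwasawa theory of elliptic curves with complex multiplication* (1987), I.3.1 (p. 15–16) and II.4.14 (p. 71): the functions
integrated against the measures of II.4 are `p`-adic CHARACTERS `ε : 𝒢 → ℂ_p^×` (grössencharacters of type `(k, j)` read `p`-adically); their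
continuity along a tower `Gal(K̄/K(𝔣𝔭^n))` is checked on the restriction to the subgroup `G = Gal(K̄/K(𝔣))`, where `ε = κ^k` is an explicit
power of the local character (II.4.14 (36)–(38)).  THIS file isolates the group-theoretic step used there:

* ★ `isTowerContinuous_of_mul_of_tendsto_one` — a multiplicative `χ : G → 𝕜` (`χ(xy) = χ(x)χ(y)`) with `sup_{u ∈ U_n} ‖χ(u) − 1‖ → 0` is
  tower-continuous (`χ` is automatically bounded: finitely many cosets of `U_N`);
* `norm_le_of_mul_of_forall_mem` — the boundedness step.

Everything is a theorem; no named facts, no instances, no `sorry`.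

## References

* [deShalit1987] E. de Shalit, *Iwasawa theory of elliptic curves with complex multiplication* (1987), I.3.1 (p. 15–16), II.4.14 (36)–(38)
  (p. 71–72).
-/

noncomputable section

open Filter
open scoped Topology Classical

namespace Literature.NumberTheory.EllipticCurves

namespace SubgroupTower

variable {G : Type*} [Group G] (𝒰 : SubgroupTower G) {𝕜 : Type*} [NormedField 𝕜]

/-- **A multiplicative function bounded near `1` on a level `U_N` is bounded on `G`**: every `σ` is `r_c · u` with `r_c` one of the finitely many
representatives of `G/U_N` and `u ∈ U_N`. [cite: deShalit1987, I.3.1 (p. 15–16)] -/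
theorem norm_le_of_mul_of_forall_mem {χ : G → 𝕜} (hmul : ∀ x y, χ (x * y) = χ x * χ y) {N : ℕ} {B : ℝ}
    (hB : ∀ u ∈ 𝒰.U N, ‖χ u‖ ≤ B) (σ : G) :
    ‖χ σ‖ ≤ ((𝒰.cells N).sup' ⟨𝒰.proj N 1, 𝒰.mem_cells N _⟩ fun c ↦ ‖χ (𝒰.repr N c)‖) * B := by
  have hu : (𝒰.repr N (𝒰.proj N σ))⁻¹ * σ ∈ 𝒰.U N := 𝒰.proj_eq_iff.mp (𝒰.proj_repr N _)
  have hσ : σ = 𝒰.repr N (𝒰.proj N σ) * ((𝒰.repr N (𝒰.proj N σ))⁻¹ * σ) := by rw [mul_inv_cancel_left]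
  rw [hσ, hmul, norm_mul]
  exact mul_le_mul (Finset.le_sup' (fun c ↦ ‖χ (𝒰.repr N c)‖) (𝒰.mem_cells N _)) (hB _ hu) (norm_nonneg _)
    (le_trans (norm_nonneg _) (Finset.le_sup' (fun c ↦ ‖χ (𝒰.repr N c)‖) (𝒰.mem_cells N (𝒰.proj N σ))))

/-- ★ **A multiplicative function tending to `1` along the tower is tower-continuous**: if `χ(xy) = χ(x)χ(y)` and for every `ε > 0` there is
`N` with `‖χ(u) − 1‖ < ε` for all `u ∈ U_n`, `n ≥ N`, then `χ` is tower-continuous (for `σU_n = τU_n`: `χ(τ) − χ(σ) = χ(σ)(χ(σ⁻¹τ) − 1)`,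
and `χ` is bounded by `norm_le_of_mul_of_forall_mem`). [cite: deShalit1987, I.3.1 (p. 15–16), II.4.14 (38) (p. 71–72)] -/
theorem isTowerContinuous_of_mul_of_tendsto_one {χ : G → 𝕜} (hmul : ∀ x y, χ (x * y) = χ x * χ y)
    (h1 : ∀ ε : ℝ, 0 < ε → ∃ N : ℕ, ∀ n, N ≤ n → ∀ u ∈ 𝒰.U n, ‖χ u - 1‖ < ε) : 𝒰.IsTowerContinuous χ := by
  -- boundedness
  obtain ⟨N₀, hN₀⟩ := h1 1 one_pos
  have hB : ∀ u ∈ 𝒰.U N₀, ‖χ u‖ ≤ 2 := fun u hu ↦ by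
    have h := hN₀ N₀ le_rfl u hu
    calc ‖χ u‖ = ‖(χ u - 1) + 1‖ := by rw [sub_add_cancel]
      _ ≤ ‖χ u - 1‖ + ‖(1 : 𝕜)‖ := norm_add_le _ _
      _ ≤ 1 + 1 := by rw [norm_one]; exact add_le_add h.le le_rfl
      _ = 2 := by norm_num
  set C : ℝ := ((𝒰.cells N₀).sup' ⟨𝒰.proj N₀ 1, 𝒰.mem_cells N₀ _⟩ fun c ↦ ‖χ (𝒰.repr N₀ c)‖) * 2 with hC
  have hχC : ∀ σ, ‖χ σ‖ ≤ C := fun σ ↦ norm_le_of_mul_of_forall_mem 𝒰 hmul hB σ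
  have hC0 : 0 ≤ C := le_trans (norm_nonneg _) (hχC 1)
  intro ε hε
  obtain ⟨N, hN⟩ := h1 (ε / (C + 1)) (div_pos hε (by linarith))
  refine ⟨N, fun n hn σ τ hστ ↦ ?_⟩
  have hu : σ⁻¹ * τ ∈ 𝒰.U n := 𝒰.proj_eq_iff.mp hστ
  have hτ : χ τ = χ σ * χ (σ⁻¹ * τ) := by rw [← hmul, mul_inv_cancel_left]
  rw [dist_eq_norm, hτ, ← mul_one (χ σ), mul_assoc, one_mul, ← mul_sub, norm_mul, norm_sub_rev]
  calc ‖χ σ‖ * ‖χ (σ⁻¹ * τ) - 1‖ ≤ C * (ε / (C + 1)) :=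
        mul_le_mul (hχC σ) (hN n hn _ hu).le (norm_nonneg _) hC0
    _ < ε := by rw [mul_div_assoc']; rw [div_lt_iff₀ (by linarith)]; nlinarith

end SubgroupTower

end Literature.NumberTheory.EllipticCurves

end
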